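import Summits.ValiantsHypothesis.ValiantsHypothesis.Theorems.DepthWindowSmallSegment

/-!
# Route `DepthWindow` — the EXTRACTION level of the universal slope-2 builder

Cone-free helper (decomp-valiant lens 4, g16) supporting the crux item `HomImmHardTwoOne`
(stmt-ValiantsHypothesis-30635).  Level `2i+1` of the universal builder for `ULB₂` (`DepthWindowULBReduction`,
statement `TwoLevelRound`): from a pool `U` of letters of modulus `≤ v`, extract disjoint groups of at most `ℓ`
letters with `ℓ·|Σ| < 2v` (`exists_small_segment`) until fewer than `ℓ` positive or fewer than `ℓ` negative
non-small letters of `U` are left as singletons.  The grouping is recorded as an idempotent LEADER MAP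
`L : Fin n → Fin n` (the group of `i` is the fibre `{j | L j = L i}`):

* `exists_extraction` — there is an idempotent leader map all of whose fibres are either singletons or extracted
  groups inside `U` (`ℓ·|Σ| < 2v`, mass `≤ ℓ·v`), every position outside `U` being a singleton, such that the
  singleton fibres `{i} ⊆ U` with `ℓ·|xᵢ| ≥ 2v` number `< ℓ` among the positive letters or `< ℓ` among the
  negative ones.

References: [LimayeSrinivasanTavenas2022] full version ECCC TR22-090, Algorithm 1 (greedy extraction phase);
[BhargavDuttaSaxena2024] ACM ToCT 16(4):23 §5.
-/

-- layout Summits/ValiantsHypothesis/ValiantsHypothesis forces the duplicated namespace component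
set_option linter.dupNamespace false

namespace Summit.ValiantsHypothesis.ValiantsHypothesis.Theorems.DepthWindow.TreeBias

open Finset

variable {n : ℕ}

/-- **Iterated extraction.**  See the module docstring: an idempotent leader map whose fibres are singletons or
small-sum groups inside `U`, leaving fewer than `ℓ` big singleton letters of one sign in `U`.
[cite: LimayeSrinivasanTavenas2022, Algorithm 1] -/
theorem exists_extraction (x : Fin n → ℤ) {v ℓ : ℕ} (hℓ : 1 ≤ ℓ) :
    ∀ (U : Finset (Fin n)), (∀ i ∈ U, |x i| ≤ v) →
    ∃ L : Fin n → Fin n,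
      (∀ i, L (L i) = L i) ∧
      (∀ j, j ∉ U → ∀ i, L i = j ↔ i = j) ∧
      (∀ i, (∀ j, L j = L i ↔ j = i) ∨
        ((∀ j, L j = L i → j ∈ U) ∧
          (ℓ : ℤ) * |∑ j ∈ univ.filter (fun j => L j = L i), x j| < 2 * v ∧
          ∑ j ∈ univ.filter (fun j => L j = L i), |x j| ≤ (ℓ : ℤ) * v)) ∧
      ((U.filter fun i => (∀ j, L j = L i ↔ j = i) ∧ ¬ ((ℓ : ℤ) * |x i| < 2 * v) ∧ 0 < x i).card < ℓ ∨
        (U.filter fun i => (∀ j, L j = L i ↔ j = i) ∧ ¬ ((ℓ : ℤ) * |x i| < 2 * v) ∧ x i < 0).card < ℓ) := by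
  classical
  intro U
  induction U using Finset.strongInduction with
  | H U ih =>
    intro hU
    by_cases hgo : ℓ ≤ (U.filter fun i => 0 < x i).card ∧ ℓ ≤ (U.filter fun i => x i < 0).card
    · -- extract one segment and recurse on the rest
      obtain ⟨S, hSU, hSne, hScard, hSsum, hSmass⟩ := exists_small_segment x U hℓ hU hgo.1 hgo.2
      have hss : U \ S ⊂ U := sdiff_ssubset hSU hSne
      obtain ⟨L', hidem', hout', hfib', hrest'⟩ := ih (U \ S) hss fun i hi => hU i (mem_sdiff.1 hi).1
      set s₀ := S.min' hSne with hs₀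
      have hs₀S : s₀ ∈ S := min'_mem S hSne
      -- elements of S are singletons of L'
      have hSout : ∀ j ∈ S, ∀ i, L' i = j ↔ i = j :=
        fun j hj => hout' j (fun h => (mem_sdiff.1 h).2 hj)
      have hL'self : ∀ j ∈ S, L' j = j := fun j hj => (hSout j hj j).2 rfl
      -- leaders of elements outside S stay outside S
      have hL'notS : ∀ i, i ∉ S → L' i ∉ S := by
        intro i hi hmem
        have := (hSout (L' i) hmem i).1 rfl
        rw [this] at hi; exact hi hmem
      let L : Fin n → Fin n := fun i => if i ∈ S then s₀ else L' i
      have hLS : ∀ i ∈ S, L i = s₀ := fun i hi => by simp [L, hi]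
      have hLnS : ∀ i, i ∉ S → L i = L' i := fun i hi => by simp [L, hi]
      -- fibre of s₀ is S; other fibres are those of L'
      have hfibS : ∀ j, L j = s₀ ↔ j ∈ S := by
        intro j
        by_cases hj : j ∈ S
        · simp [hLS j hj, hj]
        · rw [hLnS j hj]
          constructor
          · intro h; exact absurd ((hSout s₀ hs₀S j).1 h ▸ hs₀S) hj
          · intro h; exact absurd h hj
      have hfibnS : ∀ i, i ∉ S → ∀ j, L j = L i ↔ L' j = L' i := by
        intro i hi j
        rw [hLnS i hi]
        by_cases hj : j ∈ S
        · rw [hLS j hj]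
          constructor
          · intro h; exact absurd (h ▸ hs₀S) (hL'notS i hi)
          · intro h
            have := (hSout j hj j).2 rfl  -- L' j = j
            rw [this] at h
            exact absurd (h ▸ hj) (hL'notS i hi)
        · rw [hLnS j hj]
      refine ⟨L, fun i => ?_, fun j hj i => ?_, fun i => ?_, ?_⟩
      · -- idempotent
        by_cases hi : i ∈ S
        · rw [hLS i hi, hLS s₀ hs₀S]
        · rw [hLnS i hi, hLnS (L' i) (hL'notS i hi), hidem']
      · -- outside U: singletons
        have hjS : j ∉ S := fun h => hj (hSU h)
        have hjU' : j ∉ U \ S := fun h => hj (mem_sdiff.1 h).1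
        by_cases hi : i ∈ S
        · rw [hLS i hi]
          constructor
          · intro h; exact absurd (h ▸ hs₀S) hjS
          · intro h; exact absurd (h ▸ hi) hjS
        · rw [hLnS i hi]; exact hout' j hjU' i
      · -- fibre classification
        by_cases hi : i ∈ S
        · right
          have hset : univ.filter (fun j => L j = L i) = S := by
            ext j; simp [hLS i hi, hfibS j]
          rw [hset]
          refine ⟨fun j hj => hSU ((hfibS j).1 (by rw [hj, hLS i hi])), hSsum, hSmass⟩
        · have hset : univ.filter (fun j => L j = L i) = univ.filter (fun j => L' j = L' i) := by
            ext j; simp [hfibnS i hi j]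
          rcases hfib' i with h1 | ⟨h2, h3, h4⟩
          · left; intro j; rw [hfibnS i hi j]; exact h1 j
          · right
            rw [hset]
            exact ⟨fun j hj => (mem_sdiff.1 (h2 j ((hfibnS i hi j).1 hj))).1, h3, h4⟩
      · -- rest count: the big singletons of U for L are big singletons of U \ S for L'
        have hsub : ∀ (P : Fin n → Prop) [DecidablePred P],
            (U.filter fun i => (∀ j, L j = L i ↔ j = i) ∧ ¬ ((ℓ : ℤ) * |x i| < 2 * v) ∧ P i) ⊆
            ((U \ S).filter fun i => (∀ j, L' j = L' i ↔ j = i) ∧ ¬ ((ℓ : ℤ) * |x i| < 2 * v) ∧ P i) := by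
          intro P _ i hi
          rw [mem_filter] at hi ⊢
          obtain ⟨hiU, hsing, hbig, hP⟩ := hi
          -- i ∉ S: otherwise S = {i} would be small
          have hiS : i ∉ S := by
            intro hiS
            have hSi : S = {i} := by
              ext j
              rw [mem_singleton, ← hfibS j, ← hsing j, hLS i hiS]
            apply hbig
            simpa [hSi] using hSsum
          refine ⟨mem_sdiff.2 ⟨hiU, hiS⟩, fun j => ?_, hbig, hP⟩
          rw [← hfibnS i hiS j]; exact hsing j
        rcases hrest' with h | h
        · left; exact lt_of_le_of_lt (card_le_card (hsub _)) h
        · right; exact lt_of_le_of_lt (card_le_card (hsub _)) h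
    · -- nothing (more) to extract: the identity
      refine ⟨id, fun i => rfl, fun j _ i => Iff.rfl, fun i => Or.inl fun j => Iff.rfl, ?_⟩
      rw [not_and_or, not_le, not_le] at hgo
      rcases hgo with h | h
      · left
        refine lt_of_le_of_lt (card_le_card fun i hi => ?_) h
        rw [mem_filter] at hi ⊢; exact ⟨hi.1, hi.2.2.2⟩
      · right
        refine lt_of_le_of_lt (card_le_card fun i hi => ?_) h
        rw [mem_filter] at hi ⊢; exact ⟨hi.1, hi.2.2.2⟩

end Summit.ValiantsHypothesis.ValiantsHypothesis.Theorems.DepthWindow.TreeBias
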